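import Mathlib.NumberTheory.LegendreSymbol.JacobiSymbol
import Literature.Computability.Complexity.SymPlus
import Literature.Computability.Complexity.BoolEncodings
import HarnessLib

/-!
# Vocabulary of the Jacobi level-set line for crux `CircuitNpAcc0` (route `Circuit`, stmt-PneNP-0037)

Route-posited objects (D-0016 `…Defs.lean`) of the line `Sketch` / road `jacobi-levelset-discrepancy`
(crux card `Summits/PneNP/PneNP/Cruxes/CircuitNpAcc0/Ideas/jacobi-levelset-discrepancy.md`, registered
skeleton `…/Cruxes/CircuitNpAcc0/Lines/Sketch.lean`), which reduces the crux
`¬ (NP ⊆ ACC⁰)` to a character-sum statement: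

* `jacobiPairSym w` — the Jacobi symbol `(N(u) | 2·N(v) + 1)` of the two halves of a word `w`
  (`u` = first `⌊|w|/2⌋` bits, `v` = the rest, little-endian values `bitsToNat`);
* `JACOBI₂ = {w | jacobiPairSym w = 1}` — the witness language (in `P`:
  `Theorems/CircuitCircuitNpAcc0StubJacobi2MemP.lean`, stated there with the set unfolded);
* `chi₂ n` — its slice character on `Fin n → Bool`;
* `LevelSetDiscrepancy χ` — the level-set discrepancy property of a slice character `χ` against
  quasi-polynomial-size, polylog-fan-in `SYM⁺` term systems (`Literature.Computability.Complexity.SymPlus`).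
  The line's transferred crux C⁺ is `LevelSetDiscrepancy chi₂` — an OPEN conjecture (real-character
  cancellation over level sets of admissible digit polynomials), deliberately a predicate applied to
  `chi₂` and not a closed `Prop`, so that nothing here poses as a vendored fact.

Why these shapes: `ACC⁰ ⊆ SYM⁺` is a proved tree theorem (`Williams2014_symPlus_of_acc_holds`), packaged at
the language level with exactly the bounds `2 ^ (log₂ n + 2) ^ e` / `(log₂ n + 2) ^ e` used below
(`stub_symPlus_of_mem_ACC0`, `Theorems/CircuitCircuitNpAcc0StubSymPlusOfMemACC0.lean`); the level-set
pigeonhole is `stub_levelset_bias_of_symPlus` (`Theorems/CircuitCircuitNpAcc0StubLevelsetBiasOfSymPlus.lean`).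
No theorem is proved in this file.
-/

set_option linter.dupNamespace false -- `Summit.PneNP.PneNP.…`: summit = sub-problem (D-0017)

namespace Summit.PneNP.PneNP.Theorems.CircuitNpAcc0

open Finset Literature.Computability.Complexity

/-- `χ₂(w) = (N(u) | 2·N(v) + 1)`: the Jacobi symbol of the two halves of the word `w` — `u` = the first
`⌊|w|/2⌋` bits, `v` = the remaining `⌈|w|/2⌉` bits, both read as little-endian binary numerals
(`bitsToNat`). The bottom argument `2·N(v) + 1` is odd and positive, so Mathlib's `jacobiSym` is the genuine
Jacobi symbol; values in `{0, 1, -1}` (`jacobiSym.trichotomy`), `0` iff `gcd(N(u), 2N(v)+1) ≠ 1`. -/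
def jacobiPairSym (w : List Bool) : ℤ :=
  jacobiSym (bitsToNat (w.take (w.length / 2)) : ℤ) (2 * bitsToNat (w.drop (w.length / 2)) + 1)

/-- The witness language `JACOBI₂ = {w | χ₂(w) = +1}` of the line (the modulus `2N(v)+1` is part of the
input, so character sums over its level sets are AVERAGES over moduli). It is in `P` (binary Jacobi
algorithm; `stub_jacobi2_mem_P`). -/
def JACOBI₂ : Language Bool :=
  {w | jacobiPairSym w = 1}

/-- The slice character `chi₂ n : (Fin n → Bool) → ℤ`, `x ↦ χ₂(List.ofFn x)`; the `n`-th slice of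
`JACOBI₂` is `[chi₂ n · = 1]` (`Language.sliceFn`, definitional). -/
def chi₂ (n : ℕ) (x : Fin n → Bool) : ℤ :=
  jacobiPairSym (List.ofFn x)

/-- **Level-set discrepancy** of a slice character `χ` (the shape of the line's transferred crux): for every
exponent `e`, for all large `n`, every `SYM⁺` term system `S` on `n` variables with at most
`2 ^ (log₂ n + 2) ^ e` AND-terms, each of fan-in at most `(log₂ n + 2) ^ e`, and every level `v`, the sum of
`χ n` over the level set `{x | count_S x = v}`, times the number of levels `size + 1`, stays below
`#{x | χ n x ≠ 0}` — no level set of an admissible digit polynomial carries a `1/(size+1)` share of full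
character bias. The line's C⁺ is `LevelSetDiscrepancy chi₂` (OPEN: real-character cancellation over such
level sets; the separable case would follow from Heath-Brown's quadratic large sieve, Acta Arith. 72 (1995),
Thm. 1). With the language-level Beigel–Tarui theorem and the level-set pigeonhole it implies
`JACOBI₂ ∉ ACC⁰`, hence the crux. -/
def LevelSetDiscrepancy (χ : (n : ℕ) → (Fin n → Bool) → ℤ) : Prop :=
  ∀ e : ℕ, ∃ n₀ : ℕ, ∀ n ≥ n₀, ∀ S : SymPlus n,
    S.size ≤ 2 ^ (Nat.log 2 n + 2) ^ e → S.maxFanIn ≤ (Nat.log 2 n + 2) ^ e →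
    ∀ v : ℕ, |∑ x ∈ univ.filter (fun x => S.count x = v), χ n x| * ((S.size : ℤ) + 1) <
      ((univ.filter fun x => χ n x ≠ 0).card : ℤ)

end Summit.PneNP.PneNP.Theorems.CircuitNpAcc0
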